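import Summits.QuantumFields.BalabanUV.T4Continuum.Support.ShellMeasureMinimiserDecay

/-!
# `T4Continuum.ShellMeasureMinimiserDecayAccretive` — ROW S123 (J8) file 2: THE SANDWICHED INVERSE AND THE MINIMISER FOR AN
# ACCRETIVE (NOT NECESSARILY HERMITIAN) FINE KERNEL — the «complexified along the contraction ray» qualifier of E1∕E2∕E3: the sandwich
# `Q A⁻¹ Q*` of an ACCRETIVE `A` (`Re z^*Az ≥ m_A‖z‖²`) is `Re`-coercive with `m_A ∕ E` whenever a reconstruction `QR = 1` has bounded
# OPERATOR energy `‖Aᴴ R B‖² ≤ E‖B‖²` (Cauchy–Schwarz, no completion of squares, no holomorphy), so file 1's chain runs verbatim with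
# `a⁻¹ ↦ m_A ∕ E`
(cell `pub-balaban`, sub-cell `t4`, spine estimate NE7c (node U5b); NE7c ROUND-2 crew `t4-ne7c-formalise-*`, unit
`b2b-balaban-t4-ne7c-formalise-leaf-07` gen 11; owner table `t4/b2b-balaban-t4-ne7c-p1/LEAVES-NE7c-P1.md` ROW **S123 = J8** (GO R-ne7cp1-g37-12),
file 2 over file 1 `ShellMeasureMinimiserDecay` p243980; ADDITIVE — imports file 1 ONLY; [folklore] finite-dimensional linear algebra;
theorems only, 0 `def`, 0 `def … : Prop`, 0 sorry, 0 citation tags; touches NO host; moves NO census row.)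

HONEST FRAMING.  Finite four-torus programme, rung (B)+1 only — NOT infinite volume, NOT a mass gap, NOT the Clay problem, NOT summit
progress.  NE7c (`T4IndicatorShell.ShellWeightBound`) is NOT PRINTED in [Balaban 1983–89] and NOT PROVED; «NE7c ⇐ the named binders»
(trigger c3).  File 1 treated a HERMITIAN `Re`-coercive `A` (the sandwich's coercivity by completion of squares,
`Beta/UnitLatticeProjectionWalk.sandwich_coercive_of_reconstruction`).  The E1∕E2∕E3 rows of the ONE CALL are stated for operators
«SECTIONED on the block, block variables COMPLEXIFIED along the contraction ray» (census §13), i.e. for NON-Hermitian, ACCRETIVE fine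
kernels (ROW S121 = J6's species: `levelOp + P`, `Re z^*Pz ≥ 0`).  This file removes «Hermitian»: §1 proves the sandwich's `Re`-coercivity
for an ACCRETIVE `A` from an operator-energy reconstruction; §2 restates file 1's §2–§3 chain GENERICALLY in the sandwich's coercivity
constant `c` (so that file 1's Hermitian `a⁻¹` and §1's accretive `m_A∕E` are both instances); §3 the accretive ENDs; §4 a G-1 toy.
Locators as in file 1 ([B5] (1.100)–(1.103) p. 34, [B9] (3.126)∕(3.129)∕(3.132) pp. 420–422, [B11] (45)–(46) p. 285) — SHAPES, not
citations (ABSOLUTE RULE).  NOT here: which `A q r` Bałaban's scheme produces (node O ∕ J1–J3; for the MODEL along the ray the uniform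
conjugated coercivity `hc` is ROW S121 = J6's `decay_levelOp_add_complexRay`∕`…_firstOrder` budget, the energy `E` a bump computation);
the gauge identity `RD*HB = 0`.  E2∕E3∕E6 rows stay DISPLAYED; census COUNT unchanged; nothing of Bałaban's asserted, cited or discharged.
HONEST DEPENDENCY (cell): continuum YM on T⁴ ⇐ BetaPertH ∧ nine spine estimates (0/9 proved); BetaPertH ⇐ (D1) ∧ (D4) ∧ CAP+tail;
G-an2-4 gates asym, D1 and NE2/3/4.

CONTENT.
* §1 **`sandwich_reCoercive_of_accretive`**: `Re z^*Az ≥ m_A‖z‖²` (`m_A > 0`), `Qm r·(Qm q)ᴴ = 1`, `‖Aᴴ(Rᴴ B)‖² ≤ E‖B‖²` (`E > 0`) ⟹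
  `(m_A∕E)‖B‖² ≤ Re B^*(QA⁻¹Q*)B`.  Proof: with `w = Qᴴ B = A g`, `‖B‖² = (Rᴴ B)^* w = (Aᴴ Rᴴ B)^* g ≤ √(E‖B‖²)·‖g‖` and
  `Re B^*SB = Re w^*A⁻¹w = Re g^*Ag ≥ m_A‖g‖²`.
* §2 generic in the sandwich's coercivity `c`: **`norm_sandwich_inv_apply_le_of_reCoercive`** (`‖S⁻¹(y,y′)‖ ≤ e^{−κ₁D}∕(c − κ₁(N∕m)L₁)`),
  `Qm_mul_minimiser_of_reCoercive`, **`norm_minimiser_apply_le_of_reCoercive`** (`‖H(x,y)‖ ≤ (√N·L∕(m(c − κ₁(N∕m)L₁)))·e^{−κ₁D(blk x,y)}`),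
  **`norm_minimiser_mulVec_le_of_reCoercive`** — file 1's proofs with `a⁻¹ ↦ c`; NO Hermitian hypothesis anywhere.
* §3 the ACCRETIVE ENDs **`norm_sandwich_inv_apply_le_of_accretive`**, **`norm_minimiser_apply_le_of_accretive`** (`c := m_A∕E`).
* §4 rule G-1: the one-site toy inhabits every hypothesis of the accretive END.
-/

noncomputable section

open Finset Matrix
open scoped Matrix ComplexConjugate BigOperators

namespace Summit.QuantumFields.BalabanUV.T4Continuum.ShellMeasureMinimiserDecayAccretive

open Summit.QuantumFields.BalabanUV.Beta.AccretiveCombesThomas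
open Summit.QuantumFields.BalabanUV.Beta.AccretiveCombesThomasSandwich
open Summit.QuantumFields.BalabanUV.Beta.UnitLatticeResolventWalk (Qm superpose sandwich_eq_mul form_sandwich_eq)
open Summit.QuantumFields.BalabanUV.Beta.UnitLatticeProjectionWalk (star_superpose_dotProduct)
open Summit.QuantumFields.BalabanUV.Beta.PropagatorWoodburyFibre (pivot effForm minimiser constraint_mul_minimiser)
open Summit.QuantumFields.BalabanUV.T4Continuum.ShellMeasureMinimiserDecay
open Literature.MathematicalPhysics.QuantumFieldTheory.Balaban1983to89.B5Prop11Lower (nsq nsq_nonneg star_dotProduct_self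
  norm_star_dotProduct_le)

variable {X Y : Type*} [Fintype X] [DecidableEq X] [Fintype Y] [DecidableEq Y]

/-! ## §1 The sandwich of an ACCRETIVE kernel is `Re`-coercive (operator-energy reconstruction) -/

/-- **`Re`-COERCIVITY OF `Q A⁻¹ Q*` FOR AN ACCRETIVE `A`.**  `Re z^*Az ≥ m_A‖z‖²` with `m_A > 0` (so `A` is invertible), a
reconstruction `Qm r·(Qm q)ᴴ = 1` with OPERATOR energy `‖Aᴴ(Rᴴ B)‖² ≤ E‖B‖²`, `E > 0` ⟹ `(m_A∕E)‖B‖² ≤ Re B^*(sandwich A q)B`.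
No Hermitian hypothesis, no holomorphy. [folklore] -/
theorem sandwich_reCoercive_of_accretive (A : Matrix X X ℂ) {mA : ℝ} (hmA0 : 0 < mA)
    (hmA : ∀ g : X → ℂ, mA * nsq g ≤ (star g ⬝ᵥ (A *ᵥ g)).re)
    (q r : Y → X → ℂ) (hbi : Qm r * (Qm q)ᴴ = 1) {E : ℝ} (hE : 0 < E)
    (hEop : ∀ B : Y → ℂ, nsq (Aᴴ *ᵥ superpose r B) ≤ E * nsq B) (B : Y → ℂ) :
    mA / E * nsq B ≤ (star B ⬝ᵥ (sandwich A q *ᵥ B)).re := by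
  have hU : IsUnit A := isUnit_of_reCoercive hmA0 hmA
  have hdet : IsUnit A.det := (Matrix.isUnit_iff_isUnit_det A).mp hU
  set w : X → ℂ := superpose q B with hw
  set g : X → ℂ := A⁻¹ *ᵥ w with hg
  have hAg : A *ᵥ g = w := by rw [hg, Matrix.mulVec_mulVec, Matrix.mul_nonsing_inv A hdet, Matrix.one_mulVec]
  -- Re B^* S B = Re g^* A g ≥ m_A ‖g‖²
  have hform : (star B ⬝ᵥ (sandwich A q *ᵥ B)).re = (star g ⬝ᵥ (A *ᵥ g)).re := by
    rw [form_sandwich_eq, ← hw, ← hg, ← hAg]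
    have h : star (A *ᵥ g) ⬝ᵥ g = star (star g ⬝ᵥ (A *ᵥ g)) := by
      rw [← Matrix.star_dotProduct_star, star_star]
    rw [h, Complex.star_def, Complex.conj_re]
  have hlow : mA * nsq g ≤ (star B ⬝ᵥ (sandwich A q *ᵥ B)).re := by rw [hform]; exact hmA g
  -- ‖B‖² = (Rᴴ B)^* w = (Aᴴ Rᴴ B)^* g ≤ √(E‖B‖²)·√(‖g‖²)
  have hbi' : star (superpose r B) ⬝ᵥ w = ((nsq B : ℝ) : ℂ) := star_superpose_dotProduct q r hbi B
  have hpair : star (superpose r B) ⬝ᵥ w = star (Aᴴ *ᵥ superpose r B) ⬝ᵥ g := by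
    rw [← hAg, Matrix.star_mulVec, Matrix.conjTranspose_conjTranspose, ← Matrix.dotProduct_mulVec]
  have hns : nsq B ≤ Real.sqrt (E * nsq B) * Real.sqrt (nsq g) := by
    have h1 : ‖star (Aᴴ *ᵥ superpose r B) ⬝ᵥ g‖ ≤ Real.sqrt (nsq (Aᴴ *ᵥ superpose r B)) * Real.sqrt (nsq g) :=
      norm_star_dotProduct_le _ _
    rw [← hpair, hbi', Complex.norm_real, Real.norm_of_nonneg (nsq_nonneg B)] at h1
    exact h1.trans (mul_le_mul_of_nonneg_right (Real.sqrt_le_sqrt (hEop B)) (Real.sqrt_nonneg _))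
  -- hence ‖B‖² ≤ E‖g‖²
  have hB0 := nsq_nonneg B
  have hg0 := nsq_nonneg g
  have hsq : nsq B * nsq B ≤ (E * nsq B) * nsq g := by
    have h2 := mul_le_mul hns hns hB0 (by positivity)
    calc nsq B * nsq B ≤ (Real.sqrt (E * nsq B) * Real.sqrt (nsq g)) * (Real.sqrt (E * nsq B) * Real.sqrt (nsq g)) := h2
      _ = (Real.sqrt (E * nsq B) * Real.sqrt (E * nsq B)) * (Real.sqrt (nsq g) * Real.sqrt (nsq g)) := by ring
      _ = (E * nsq B) * nsq g := by rw [Real.mul_self_sqrt (by positivity), Real.mul_self_sqrt hg0]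
  have hle : nsq B ≤ E * nsq g := by
    by_cases hB : nsq B = 0
    · rw [hB]; positivity
    · have hBpos : 0 < nsq B := lt_of_le_of_ne hB0 (Ne.symm hB)
      nlinarith
  calc mA / E * nsq B ≤ mA / E * (E * nsq g) := mul_le_mul_of_nonneg_left hle (by positivity)
    _ = mA * nsq g := by field_simp
    _ ≤ _ := hlow

/-! ## §2 File 1's chain, generic in the sandwich's `Re`-coercivity constant `c` (no Hermitian hypothesis) -/

/-- **THE SANDWICHED INVERSE, generic form**: `c‖B‖² ≤ Re B^*(QA⁻¹Q*)B` (`c` from file 1's `sandwich_reCoercive` in the Hermitian case,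
from §1 in the accretive case), conjugated coercivity `m` (rate `κ`) of `A` along the block-constant weights, block-supported tests
`‖q_y‖² ≤ N`, first-moment profile `L₁`, `κ₁(N∕m)L₁ < c` ⟹ `‖(QA⁻¹Q*)⁻¹(y,y′)‖ ≤ e^{−κ₁D(y,y′)}∕(c − κ₁(N∕m)L₁)`. [folklore] -/
theorem norm_sandwich_inv_apply_le_of_reCoercive (A : Matrix X X ℂ) (blk : X → Y) (D : Y → Y → ℝ) (hD0 : ∀ y, D y y = 0)
    (hDtri : ∀ i j k, D i k ≤ D i j + D j k) (hDs : ∀ i j, D i j = D j i)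
    (q : Y → X → ℂ) (hq : ∀ y x, blk x ≠ y → q y x = 0) {N : ℝ} (hN0 : 0 ≤ N) (hN : ∀ y, nsq (q y) ≤ N)
    {c : ℝ} (hcoerS : ∀ B : Y → ℂ, c * nsq B ≤ (star B ⬝ᵥ (sandwich A q *ᵥ B)).re)
    {κ m κ₁ L₁ : ℝ} (hκ : 0 ≤ κ) (hm : 0 < m) (hκ₁ : 0 ≤ κ₁)
    (hc : ∀ y', ∀ z : X → ℂ, m * nsq z ≤ (conjForm A κ (fun x => D (blk x) y') z).re)
    (hL₁ : ∀ y, ∑ y', D y y' * Real.exp (-((κ - κ₁) * D y y')) ≤ L₁)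
    (hsmall : κ₁ * (N / m) * L₁ < c) (y y' : Y) :
    ‖(sandwich A q)⁻¹ y y'‖ ≤ Real.exp (-(κ₁ * D y y')) / (c - κ₁ * (N / m) * L₁) :=
  norm_inv_apply_le_of_reCoercive_decay (sandwich A q) D hD0 hDtri hDs hκ₁ (div_nonneg hN0 hm.le) hcoerS
    (norm_sandwich_apply_le A blk D hD0 q hq hN hκ hm hc) hL₁ hsmall y y'

/-- `Q·H = 1` from ANY positive `Re`-coercivity constant of the sandwich. [folklore] -/
theorem Qm_mul_minimiser_of_reCoercive (A : Matrix X X ℂ) (q : Y → X → ℂ) {c : ℝ} (hc0 : 0 < c)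
    (hcoerS : ∀ B : Y → ℂ, c * nsq B ≤ (star B ⬝ᵥ (sandwich A q *ᵥ B)).re) :
    Qm q * minimiser A (Qm q) = 1 :=
  constraint_mul_minimiser (by rw [pivot_eq_sandwich]; exact isUnit_of_reCoercive hc0 hcoerS)

/-- **THE MINIMISER's E6 ROW, generic form** (file 1's `norm_minimiser_apply_le` with `a⁻¹ ↦ c`, no Hermitian hypothesis):
`‖H(x,y)‖ ≤ (√N·L∕(m(c − κ₁(N∕m)L₁)))·e^{−κ₁·D(blk x, y)}`. [folklore] -/
theorem norm_minimiser_apply_le_of_reCoercive (A : Matrix X X ℂ) (blk : X → Y) (D : Y → Y → ℝ) (hD0 : ∀ y, D y y = 0)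
    (hDtri : ∀ i j k, D i k ≤ D i j + D j k) (hDs : ∀ i j, D i j = D j i)
    (q : Y → X → ℂ) (hq : ∀ y x, blk x ≠ y → q y x = 0) {N : ℝ} (hN0 : 0 ≤ N) (hN : ∀ y, nsq (q y) ≤ N)
    {c : ℝ} (hcoerS : ∀ B : Y → ℂ, c * nsq B ≤ (star B ⬝ᵥ (sandwich A q *ᵥ B)).re)
    {κ m κ₁ L₁ L : ℝ} (hκ : 0 ≤ κ) (hm : 0 < m) (hκ₁ : 0 ≤ κ₁)
    (hc : ∀ y', ∀ z : X → ℂ, m * nsq z ≤ (conjForm A κ (fun x => D (blk x) y') z).re)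
    (hL₁ : ∀ y, ∑ y', D y y' * Real.exp (-((κ - κ₁) * D y y')) ≤ L₁)
    (hsmall : κ₁ * (N / m) * L₁ < c)
    (hL : ∀ y₀, ∑ y', Real.exp (-((κ - κ₁) * D y₀ y')) ≤ L) (x : X) (y : Y) :
    ‖minimiser A (Qm q) x y‖ ≤ Real.sqrt N * L / (m * (c - κ₁ * (N / m) * L₁)) * Real.exp (-(κ₁ * D (blk x) y)) := by
  set c' : ℝ := c - κ₁ * (N / m) * L₁ with hc'
  have hc'0 : 0 < c' := by rw [hc']; linarith
  have hS := norm_sandwich_inv_apply_le_of_reCoercive A blk D hD0 hDtri hDs q hq hN0 hN hcoerS hκ hm hκ₁ hc hL₁ hsmall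
  have hT := norm_inv_mulVec_test_le A blk D hD0 q hq hN hκ hm hc x
  rw [minimiser_eq, Matrix.mul_apply]
  have hterm : ∀ y', ‖(A⁻¹ * (Qm q)ᴴ) x y' * (sandwich A q)⁻¹ y' y‖
      ≤ Real.sqrt N / (m * c') * Real.exp (-(κ₁ * D (blk x) y)) * Real.exp (-((κ - κ₁) * D (blk x) y')) := by
    intro y'
    rw [norm_mul, inv_mul_conjTranspose_apply]
    have h1 := hT y'
    have h2 := hS y' y
    have h1' : 0 ≤ Real.sqrt N / m * Real.exp (-(κ * D (blk x) y')) := by positivity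
    have htri : Real.exp (-(κ * D (blk x) y')) * Real.exp (-(κ₁ * D y' y))
        ≤ Real.exp (-(κ₁ * D (blk x) y)) * Real.exp (-((κ - κ₁) * D (blk x) y')) := by
      rw [← Real.exp_add, ← Real.exp_add]
      refine Real.exp_le_exp.2 ?_
      have := hDtri (blk x) y' y
      nlinarith
    calc ‖(A⁻¹ *ᵥ q y') x‖ * ‖(sandwich A q)⁻¹ y' y‖
        ≤ (Real.sqrt N / m * Real.exp (-(κ * D (blk x) y'))) * (Real.exp (-(κ₁ * D y' y)) / c') :=
          mul_le_mul h1 h2 (norm_nonneg _) h1'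
      _ = Real.sqrt N / (m * c') * (Real.exp (-(κ * D (blk x) y')) * Real.exp (-(κ₁ * D y' y))) := by
          field_simp
      _ ≤ Real.sqrt N / (m * c') * (Real.exp (-(κ₁ * D (blk x) y)) * Real.exp (-((κ - κ₁) * D (blk x) y'))) :=
          mul_le_mul_of_nonneg_left htri (by positivity)
      _ = _ := by ring
  calc ‖∑ y', (A⁻¹ * (Qm q)ᴴ) x y' * (sandwich A q)⁻¹ y' y‖
      ≤ ∑ y', ‖(A⁻¹ * (Qm q)ᴴ) x y' * (sandwich A q)⁻¹ y' y‖ := norm_sum_le _ _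
    _ ≤ ∑ y', Real.sqrt N / (m * c') * Real.exp (-(κ₁ * D (blk x) y)) * Real.exp (-((κ - κ₁) * D (blk x) y')) :=
        Finset.sum_le_sum fun y' _ => hterm y'
    _ = Real.sqrt N / (m * c') * Real.exp (-(κ₁ * D (blk x) y)) * ∑ y', Real.exp (-((κ - κ₁) * D (blk x) y')) := by
        rw [Finset.mul_sum]
    _ ≤ Real.sqrt N / (m * c') * Real.exp (-(κ₁ * D (blk x) y)) * L :=
        mul_le_mul_of_nonneg_left (hL (blk x)) (by positivity)
    _ = Real.sqrt N * L / (m * c') * Real.exp (-(κ₁ * D (blk x) y)) := by ring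

/-- **(46)-shape, sup side, generic form**: `‖(HB)(x)‖ ≤ C_H·L′·sup‖B‖`. [folklore] -/
theorem norm_minimiser_mulVec_le_of_reCoercive (A : Matrix X X ℂ) (blk : X → Y) (D : Y → Y → ℝ) (hD0 : ∀ y, D y y = 0)
    (hDtri : ∀ i j k, D i k ≤ D i j + D j k) (hDs : ∀ i j, D i j = D j i)
    (q : Y → X → ℂ) (hq : ∀ y x, blk x ≠ y → q y x = 0) {N : ℝ} (hN0 : 0 ≤ N) (hN : ∀ y, nsq (q y) ≤ N)
    {c : ℝ} (hcoerS : ∀ B : Y → ℂ, c * nsq B ≤ (star B ⬝ᵥ (sandwich A q *ᵥ B)).re)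
    {κ m κ₁ L₁ L L' : ℝ} (hκ : 0 ≤ κ) (hm : 0 < m) (hκ₁ : 0 ≤ κ₁)
    (hc : ∀ y', ∀ z : X → ℂ, m * nsq z ≤ (conjForm A κ (fun x => D (blk x) y') z).re)
    (hL₁ : ∀ y, ∑ y', D y y' * Real.exp (-((κ - κ₁) * D y y')) ≤ L₁)
    (hsmall : κ₁ * (N / m) * L₁ < c)
    (hL : ∀ y₀, ∑ y', Real.exp (-((κ - κ₁) * D y₀ y')) ≤ L)
    (hL' : ∀ y₀, ∑ y, Real.exp (-(κ₁ * D y₀ y)) ≤ L') (B : Y → ℂ) {β : ℝ} (hB : ∀ y, ‖B y‖ ≤ β) (x : X) :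
    ‖(minimiser A (Qm q) *ᵥ B) x‖ ≤ Real.sqrt N * L / (m * (c - κ₁ * (N / m) * L₁)) * L' * β := by
  set C : ℝ := Real.sqrt N * L / (m * (c - κ₁ * (N / m) * L₁)) with hC
  have hc'0 : 0 < c - κ₁ * (N / m) * L₁ := by linarith
  have hL0 : 0 ≤ L := le_trans (Finset.sum_nonneg fun _ _ => (Real.exp_pos _).le) (hL (blk x))
  have hC0 : 0 ≤ C := by rw [hC]; positivity
  have hβ0 : 0 ≤ β := le_trans (norm_nonneg _) (hB (blk x))
  have hH' := norm_minimiser_apply_le_of_reCoercive A blk D hD0 hDtri hDs q hq hN0 hN hcoerS hκ hm hκ₁ hc hL₁ hsmall hL x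
  rw [Matrix.mulVec, dotProduct]
  calc ‖∑ y, minimiser A (Qm q) x y * B y‖ ≤ ∑ y, ‖minimiser A (Qm q) x y * B y‖ := norm_sum_le _ _
    _ ≤ ∑ y, C * Real.exp (-(κ₁ * D (blk x) y)) * β := Finset.sum_le_sum fun y _ => by
        rw [norm_mul]
        exact mul_le_mul (hH' y) (hB y) (norm_nonneg _) (by positivity)
    _ = C * β * ∑ y, Real.exp (-(κ₁ * D (blk x) y)) := by
        rw [Finset.mul_sum]; refine Finset.sum_congr rfl fun y _ => ?_; ring
    _ ≤ C * β * L' := mul_le_mul_of_nonneg_left (hL' (blk x)) (mul_nonneg hC0 hβ0)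
    _ = C * L' * β := by ring

/-! ## §3 The accretive ENDs (`c := m_A ∕ E`) -/

/-- **THE SANDWICHED INVERSE OF AN ACCRETIVE KERNEL IS EXPONENTIALLY LOCALISED**: `Re z^*Az ≥ m_A‖z‖²`, operator-energy reconstruction
`(r, E)`, the data of file 1 otherwise, `κ₁(N∕m)L₁ < m_A∕E` ⟹ `‖(QA⁻¹Q*)⁻¹(y,y′)‖ ≤ e^{−κ₁D(y,y′)}∕(m_A∕E − κ₁(N∕m)L₁)`. [folklore] -/
theorem norm_sandwich_inv_apply_le_of_accretive (A : Matrix X X ℂ) {mA : ℝ} (hmA0 : 0 < mA)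
    (hmA : ∀ g : X → ℂ, mA * nsq g ≤ (star g ⬝ᵥ (A *ᵥ g)).re)
    (blk : X → Y) (D : Y → Y → ℝ) (hD0 : ∀ y, D y y = 0) (hDtri : ∀ i j k, D i k ≤ D i j + D j k)
    (hDs : ∀ i j, D i j = D j i)
    (q r : Y → X → ℂ) (hq : ∀ y x, blk x ≠ y → q y x = 0) {N : ℝ} (hN0 : 0 ≤ N) (hN : ∀ y, nsq (q y) ≤ N)
    (hbi : Qm r * (Qm q)ᴴ = 1) {E : ℝ} (hE : 0 < E) (hEop : ∀ B : Y → ℂ, nsq (Aᴴ *ᵥ superpose r B) ≤ E * nsq B)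
    {κ m κ₁ L₁ : ℝ} (hκ : 0 ≤ κ) (hm : 0 < m) (hκ₁ : 0 ≤ κ₁)
    (hc : ∀ y', ∀ z : X → ℂ, m * nsq z ≤ (conjForm A κ (fun x => D (blk x) y') z).re)
    (hL₁ : ∀ y, ∑ y', D y y' * Real.exp (-((κ - κ₁) * D y y')) ≤ L₁)
    (hsmall : κ₁ * (N / m) * L₁ < mA / E) (y y' : Y) :
    ‖(sandwich A q)⁻¹ y y'‖ ≤ Real.exp (-(κ₁ * D y y')) / (mA / E - κ₁ * (N / m) * L₁) :=
  norm_sandwich_inv_apply_le_of_reCoercive A blk D hD0 hDtri hDs q hq hN0 hN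
    (sandwich_reCoercive_of_accretive A hmA0 hmA q r hbi hE hEop) hκ hm hκ₁ hc hL₁ hsmall y y'

/-- **THE MINIMISER OF AN ACCRETIVE KERNEL HAS THE E6 ROW**: `‖H(x,y)‖ ≤ (√N·L∕(m(m_A∕E − κ₁(N∕m)L₁)))·e^{−κ₁·D(blk x, y)}`. [folklore] -/
theorem norm_minimiser_apply_le_of_accretive (A : Matrix X X ℂ) {mA : ℝ} (hmA0 : 0 < mA)
    (hmA : ∀ g : X → ℂ, mA * nsq g ≤ (star g ⬝ᵥ (A *ᵥ g)).re)
    (blk : X → Y) (D : Y → Y → ℝ) (hD0 : ∀ y, D y y = 0) (hDtri : ∀ i j k, D i k ≤ D i j + D j k)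
    (hDs : ∀ i j, D i j = D j i)
    (q r : Y → X → ℂ) (hq : ∀ y x, blk x ≠ y → q y x = 0) {N : ℝ} (hN0 : 0 ≤ N) (hN : ∀ y, nsq (q y) ≤ N)
    (hbi : Qm r * (Qm q)ᴴ = 1) {E : ℝ} (hE : 0 < E) (hEop : ∀ B : Y → ℂ, nsq (Aᴴ *ᵥ superpose r B) ≤ E * nsq B)
    {κ m κ₁ L₁ L : ℝ} (hκ : 0 ≤ κ) (hm : 0 < m) (hκ₁ : 0 ≤ κ₁)
    (hc : ∀ y', ∀ z : X → ℂ, m * nsq z ≤ (conjForm A κ (fun x => D (blk x) y') z).re)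
    (hL₁ : ∀ y, ∑ y', D y y' * Real.exp (-((κ - κ₁) * D y y')) ≤ L₁)
    (hsmall : κ₁ * (N / m) * L₁ < mA / E)
    (hL : ∀ y₀, ∑ y', Real.exp (-((κ - κ₁) * D y₀ y')) ≤ L) (x : X) (y : Y) :
    ‖minimiser A (Qm q) x y‖ ≤ Real.sqrt N * L / (m * (mA / E - κ₁ * (N / m) * L₁)) * Real.exp (-(κ₁ * D (blk x) y)) :=
  norm_minimiser_apply_le_of_reCoercive A blk D hD0 hDtri hDs q hq hN0 hN
    (sandwich_reCoercive_of_accretive A hmA0 hmA q r hbi hE hEop) hκ hm hκ₁ hc hL₁ hsmall hL x y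

/-- `Q·H = 1` for an accretive `A` with an operator-energy reconstruction. [folklore] -/
theorem Qm_mul_minimiser_of_accretive (A : Matrix X X ℂ) {mA : ℝ} (hmA0 : 0 < mA)
    (hmA : ∀ g : X → ℂ, mA * nsq g ≤ (star g ⬝ᵥ (A *ᵥ g)).re)
    (q r : Y → X → ℂ) (hbi : Qm r * (Qm q)ᴴ = 1) {E : ℝ} (hE : 0 < E)
    (hEop : ∀ B : Y → ℂ, nsq (Aᴴ *ᵥ superpose r B) ≤ E * nsq B) :
    Qm q * minimiser A (Qm q) = 1 :=
  Qm_mul_minimiser_of_reCoercive A q (div_pos hmA0 hE) (sandwich_reCoercive_of_accretive A hmA0 hmA q r hbi hE hEop)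

/-! ## §4 Rule G-1: the one-site toy inhabits the accretive END -/

/-- G-1 (degenerate-but-legal): one fine site, one block, `A = 1` (accretive with `m_A = 1`), `q = r = 1`, `E = 1` (`‖1ᴴ·Rᴴ B‖² = ‖B‖²`),
`D = 0`, `κ = κ₁ = 0`, `N = m = L = 1`, `L₁ = 0`. [folklore] -/
example (x y : Fin 1) :
    ‖minimiser (1 : Matrix (Fin 1) (Fin 1) ℂ) (Qm (fun (_ : Fin 1) (_ : Fin 1) => (1 : ℂ))) x y‖
      ≤ Real.sqrt 1 * 1 / (1 * ((1 : ℝ) / 1 - 0 * (1 / 1) * 0)) * Real.exp (-(0 * (fun _ _ => (0 : ℝ)) (id x) y)) := by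
  refine norm_minimiser_apply_le_of_accretive (1 : Matrix (Fin 1) (Fin 1) ℂ) (mA := 1) one_pos ?_ id
    (fun _ _ => (0 : ℝ)) (fun _ => rfl) (fun _ _ _ => by norm_num) (fun _ _ => rfl)
    (fun _ _ => (1 : ℂ)) (fun _ _ => (1 : ℂ)) (fun y x h => absurd (Subsingleton.elim _ _) h) zero_le_one ?_ ?_ one_pos ?_
    le_rfl one_pos le_rfl ?_ ?_ (by norm_num) ?_ x y
  · intro g
    rw [Matrix.one_mulVec, star_dotProduct_self, Complex.ofReal_re, one_mul]
  · intro y'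
    simp [nsq]
  · ext i j
    simp [Matrix.mul_apply, Qm, Matrix.one_apply, Subsingleton.elim i j]
  · intro B
    rw [Matrix.conjTranspose_one, Matrix.one_mulVec, one_mul]
    unfold nsq superpose
    simp [Qm, Matrix.mulVec, dotProduct, Matrix.conjTranspose_apply]
  · intro y' z
    rw [re_conjForm_one, one_mul]
  · intro y₀; simp
  · intro y₀; simp

end Summit.QuantumFields.BalabanUV.T4Continuum.ShellMeasureMinimiserDecayAccretive

end
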